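import Mathlib
import HarnessLib
import Literature.Probability.MarkovChains.DirichletFormComparison

/-!
# Barker's acceptance vs Metropolis–Hastings: `P^{(B)} ≤ P^{(M)} ≤ 2P^{(B)}` off the diagonal, `𝓔_B ≤ 𝓔_M ≤ 2𝓔_B`, `γ_B ≤ γ_M ≤ 2γ_B`, `v(f,π,P^{(M)}) ≤ v(f,π,P^{(B)})` (Peskun 1973 §2; Levin–Peres–Wilmer Example 13.14)

HONEST FRAMING: exact (Metropolis-corrected) sampling algorithms for lattice gauge theory; figures
of merit are autocorrelation/cost numbers at stated couplings and volumes; no continuum-physics claim.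

Finite state space `X`, a proposal (trial) matrix `T : X → X → ℝ` and a positive weight `π`.
Conventions of `MetropolisHastings.lean` (`mhRate T π x y = min (T x y) (π y T y x / π x)`, the
Metropolis–Hastings kernel `mhKernel T π`, `DetailedBalance`), `TotalVariation.lean`
(`IsRowStochastic`), `PeskunOrdering.lean` (`dirichletForm π P f = 𝓔_P(f)`, `asympVar f π P = v(f,π,P)`,
Peskun's theorem and `asympVar_mhKernel_le` = Peskun's Theorem 2.2.1), `SpectralGapVariational.lean`
(`spectralGap π P = γ`) and `DirichletFormComparison.lean` (Lemma 13.18 / Remark 13.19).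
Sources: P. H. Peskun, *Optimum Monte-Carlo sampling using Markov chains*, Biometrika 60 (1973)
607–612 [Peskun1973], §1–§2 (Hastings' class `p_ij = q_ij α_ij`, `α_ij = s_ij/(1 + t_ij)`,
`t_ij = π_i q_ij/(π_j q_ji)`; the two choices `s^{(M)}_ij = 1 + min(t_ij, t_ji)` (Metropolis) and
`s^{(B)}_ij = 1` (Barker 1965)); D. A. Levin, Y. Peres (with E. L. Wilmer), *Markov Chains and
Mixing Times*, 2nd ed., AMS 2017 [LevinPeres2017], §13.3 Example 13.14 (Metropolis and Glauber
dynamics for Ising: `P(σ,σ') = (1/n)·r²/(1+r²)` (13.9) vs `P̃(σ,σ') = (1/n)(1 ∧ r²)` (13.10),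
"`½ ≤ 𝓔(f)/𝓔̃(f) ≤ 1` … Therefore, the gaps are related by `γ ≤ γ̃ ≤ 2γ`").  Everything is PROVED
(finite sums; 0 named facts).

* `barkerRate T π x y = T(x,y)·π(y)T(y,x)/(π(x)T(x,y) + π(y)T(y,x))` — Hastings' class with Barker's
  choice `s_ij ≡ 1`, i.e. acceptance `α_ij = 1/(1 + t_ij) = π_j q_ji/(π_i q_ij + π_j q_ji)`; for a
  symmetric `T` the acceptance is `π(y)/(π(x) + π(y)) = r²/(1 + r²)` with `r² = π(y)/π(x)` — the
  GLAUBER (heat-bath) dynamics of (13.9) for ±1 spins [cite: Peskun1973, §1 eqs. (2)–(3) and §2.2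
  (Hastings' choice (ii) `s_ij = 1`: "`s_ij = s^{(B)}_ij` gives Barker's (1965) sampling method")];
  [cite: LevinPeres2017, §13.3 Example 13.14 eq. (13.9)]; `barkerKernel T π` (rejected mass on the
  diagonal, as `mhKernel`), `mul_barkerRate` (the symmetric flux
  `π(x)P^{(B)}(x,y) = π(x)T(x,y)π(y)T(y,x)/(π(x)T(x,y) + π(y)T(y,x))`), `barkerKernel_detailedBalance`
  (reversibility, Hastings' condition (1)), `barkerKernel_isRowStochastic`;
* **`barkerRate_le_mhRate`: `P^{(B)} ≤ P^{(M)}` off the diagonal** — "`s_ij ≤ 1 + min(t_ij, t_ji)`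
  … equality is attained for `s_ij = s^{(M)}_ij`" [cite: Peskun1973, §2.2 eqs. (5)–(6)];
  **`mhRate_le_two_mul_barkerRate`: `P^{(M)} ≤ 2P^{(B)}` off the diagonal** — (13.9)–(13.10):
  `1 ∧ r² ≤ 2r²/(1 + r²)`, i.e. `min(a,b) ≤ 2ab/(a+b)` [cite: LevinPeres2017, §13.3 Example 13.14
  eqs. (13.9)–(13.10) ("`½ ≤ 𝓔(f)/𝓔̃(f) ≤ 1`")];
* `dirichletForm_barkerKernel_le` / `dirichletForm_mhKernel_le_two_mul`: **`𝓔_B(f) ≤ 𝓔_M(f) ≤ 2𝓔_B(f)`**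
  [cite: LevinPeres2017, §13.3 Example 13.14 ("`½ ≤ 𝓔(f)/𝓔̃(f) ≤ 1`")];
* **EXAMPLE 13.14 (gaps)** `LevinPeres2017_example_13_14`: for a positive probability vector `π`
  (`|X| ≥ 2`) and a proposal matrix `T ≥ 0` with row sums `≤ 1`, **`γ_B ≤ γ_M ≤ 2γ_B`** ("the gaps are
  related by `γ ≤ γ̃ ≤ 2γ`", `P` = Glauber/Barker, `P̃` = Metropolis) [cite: LevinPeres2017, §13.3
  Example 13.14 (last display)] — via Lemma 13.18 with `π̃ = π`;
* `asympVar_mhKernel_le_barkerKernel`: **`v(f, π, P^{(M)}) ≤ v(f, π, P^{(B)})`** for every `f` (when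
  `P^{(B)}` is irreducible) — Peskun's Theorem 2.2.1 (tree: `asympVar_mhKernel_le`) applied to the
  Barker kernel [cite: Peskun1973, §2.2 Thm 2.2.1; §2.3 (first inequality of the display
  "`v(f,π,P^{(M)}) ≤ v(f,π,P^{(B)}) ≤ …`")].

SCOPE: LPW's Example 13.14 is stated for the Ising Glauber/Metropolis pair with the uniform
single-site proposal; the typed statements are for Hastings' general class (any `T ≥ 0` with row sums
`≤ 1`, any positive `π`), of which that pair is the instance `T(σ,σ') = (1/n)·1{σ' = σ flipped at one
site}` — the proofs are the printed two-line argument verbatim (entrywise comparison of the rates,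
then monotonicity of `𝓔` and Lemma 13.7/13.18).  Not here: the second inequality of Peskun's §2.3
display (`v(f,π,P^{(B)}) ≤ v(f,π,A) + 2v(f,π,P^{(M)})`).

Context (cell pub-lqcd, venture LatticeQCDFlow): heat-bath (Glauber/Barker) versus Metropolis
acceptance is the basic local-update design choice for lattice samplers; the factor-2 sandwich says
the choice changes relaxation times by at most a factor 2 and never beats Metropolis in asymptotic
variance.
-/

namespace Literature.Probability.MarkovChains

open Finset Matrix

variable {X : Type*} [Fintype X] [DecidableEq X]

/-! ## Barker's rate and kernel -/

omit [Fintype X] [DecidableEq X] in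
/-- BARKER'S ACCEPTANCE: the off-diagonal rate `T(x,y)·π(y)T(y,x)/(π(x)T(x,y) + π(y)T(y,x))` of
Hastings' chain `p_ij = q_ij α_ij` with `s_ij ≡ 1`, `α_ij = 1/(1 + π_i q_ij/(π_j q_ji))` (value `0` when
`π(x)T(x,y) + π(y)T(y,x) = 0`).  For symmetric `T` the acceptance is `π(y)/(π(x) + π(y))` — Glauber /
heat-bath for two-valued updates, (13.9). [cite: Peskun1973, §1 eqs. (2)–(3), §2.2 ("`s_ij = s^{(B)}_ij`
gives Barker's (1965) sampling method")]; [cite: LevinPeres2017, §13.3 Example 13.14 eq. (13.9)] -/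
noncomputable def barkerRate (T : X → X → ℝ) (π : X → ℝ) (x y : X) : ℝ :=
  T x y * (π y * T y x / (π x * T x y + π y * T y x))

/-- Barker's row kernel `P^{(B)}`: off the diagonal `barkerRate`, on the diagonal the remaining
(rejected + self-proposed) mass, `p_ii = 1 − Σ_{j ≠ i} p_ij`. [cite: Peskun1973, §1 eq. (2)] -/
noncomputable def barkerKernel (T : X → X → ℝ) (π : X → ℝ) (x y : X) : ℝ :=
  if y = x then 1 - ∑ z ∈ univ.erase x, barkerRate T π x z else barkerRate T π x y

/-- Off-diagonal entries of `P^{(B)}` are the rates. [cite: Peskun1973, §1 eq. (2)] -/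
theorem barkerKernel_of_ne {T : X → X → ℝ} {π : X → ℝ} {x y : X} (h : y ≠ x) :
    barkerKernel T π x y = barkerRate T π x y := if_neg h

/-- Diagonal entry of `P^{(B)}`. [cite: Peskun1973, §1 eq. (2) (`p_ii = 1 − Σ_{j≠i} p_ij`)] -/
theorem barkerKernel_self (T : X → X → ℝ) (π : X → ℝ) (x : X) :
    barkerKernel T π x x = 1 - ∑ z ∈ univ.erase x, barkerRate T π x z := if_pos rfl

/-- Rows of `P^{(B)}` sum to one. [cite: Peskun1973, §1 eq. (2)] -/
theorem barkerKernel_sum_eq_one (T : X → X → ℝ) (π : X → ℝ) (x : X) :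
    ∑ y, barkerKernel T π x y = 1 := by
  rw [← add_sum_erase _ _ (mem_univ x), barkerKernel_self]
  have : ∑ y ∈ univ.erase x, barkerKernel T π x y = ∑ y ∈ univ.erase x, barkerRate T π x y :=
    sum_congr rfl fun y hy => barkerKernel_of_ne (ne_of_mem_erase hy)
  rw [this]
  ring

omit [Fintype X] [DecidableEq X] in
/-- The flux of Barker's chain is the symmetric expression
`π(x)P^{(B)}(x,y) = π(x)T(x,y)·π(y)T(y,x)/(π(x)T(x,y) + π(y)T(y,x))`. [cite: Peskun1973, §1 eqs. (1)–(3)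
(the construction satisfies the reversibility condition (1))] -/
theorem mul_barkerRate (T : X → X → ℝ) (π : X → ℝ) (x y : X) :
    π x * barkerRate T π x y = (π x * T x y) * (π y * T y x) / (π x * T x y + π y * T y x) := by
  unfold barkerRate
  ring

omit [Fintype X] [DecidableEq X] in
/-- Detailed balance of the rates: `π(x)P^{(B)}(x,y) = π(y)P^{(B)}(y,x)` — Hastings' reversibility
condition (1) for Barker's choice. [cite: Peskun1973, §1 eq. (1)] -/
theorem barkerRate_detailedBalance (T : X → X → ℝ) (π : X → ℝ) :
    DetailedBalance π (barkerRate T π) := by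
  intro x y
  rw [mul_barkerRate, mul_barkerRate, add_comm (π y * T y x) (π x * T x y),
    mul_comm (π y * T y x) (π x * T x y)]

/-- **Reversibility of Barker's chain**: `π(x)P^{(B)}(x,y) = π(y)P^{(B)}(y,x)` for every `π` and
every `T`. [cite: Peskun1973, §1 eq. (1) ("`P` is required to satisfy … the reversibility
condition")] -/
theorem barkerKernel_detailedBalance (T : X → X → ℝ) (π : X → ℝ) :
    DetailedBalance π (barkerKernel T π) := by
  intro x y
  by_cases h : y = x
  · subst h; rfl
  · rw [barkerKernel_of_ne h, barkerKernel_of_ne (Ne.symm h)]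
    exact barkerRate_detailedBalance T π x y

omit [Fintype X] [DecidableEq X] in
/-- `P^{(B)}(x,y) ≥ 0` for `T ≥ 0`, `π ≥ 0`. [cite: Peskun1973, §1 eq. (3) (`0 < α_ij ≤ 1`)] -/
theorem barkerRate_nonneg {T : X → X → ℝ} {π : X → ℝ} (hT : ∀ x y, 0 ≤ T x y) (hπ0 : ∀ x, 0 ≤ π x)
    (x y : X) : 0 ≤ barkerRate T π x y :=
  mul_nonneg (hT x y) (div_nonneg (mul_nonneg (hπ0 y) (hT y x))
    (add_nonneg (mul_nonneg (hπ0 x) (hT x y)) (mul_nonneg (hπ0 y) (hT y x))))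

omit [Fintype X] [DecidableEq X] in
/-- The acceptance is at most one: `P^{(B)}(x,y) ≤ T(x,y)` for `T ≥ 0`, `π ≥ 0`.
[cite: Peskun1973, §1 eq. (3) (`α_ij ≤ 1`)] -/
theorem barkerRate_le {T : X → X → ℝ} {π : X → ℝ} (hT : ∀ x y, 0 ≤ T x y) (hπ0 : ∀ x, 0 ≤ π x)
    (x y : X) : barkerRate T π x y ≤ T x y := by
  unfold barkerRate
  have h1 : π y * T y x / (π x * T x y + π y * T y x) ≤ 1 :=
    div_le_one_of_le₀ (le_add_of_nonneg_left (mul_nonneg (hπ0 x) (hT x y)))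
      (add_nonneg (mul_nonneg (hπ0 x) (hT x y)) (mul_nonneg (hπ0 y) (hT y x)))
  calc T x y * (π y * T y x / (π x * T x y + π y * T y x)) ≤ T x y * 1 :=
        mul_le_mul_of_nonneg_left h1 (hT x y)
    _ = T x y := mul_one _

/-- `P^{(B)} ≥ 0` entrywise when `T ≥ 0` has row sums `≤ 1` and `π ≥ 0`. [cite: Peskun1973, §1
eqs. (2)–(3)] -/
theorem barkerKernel_nonneg {T : X → X → ℝ} {π : X → ℝ} (hT : ∀ x y, 0 ≤ T x y)
    (hTrow : ∀ x, ∑ y, T x y ≤ 1) (hπ0 : ∀ x, 0 ≤ π x) (x y : X) : 0 ≤ barkerKernel T π x y := by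
  by_cases h : y = x
  · subst h
    rw [barkerKernel_self, sub_nonneg]
    calc ∑ z ∈ univ.erase y, barkerRate T π y z ≤ ∑ z ∈ univ.erase y, T y z :=
          sum_le_sum fun z _ => barkerRate_le hT hπ0 y z
      _ ≤ ∑ z, T y z :=
          sum_le_sum_of_subset_of_nonneg (erase_subset _ _) fun z _ _ => hT y z
      _ ≤ 1 := hTrow y
  · rw [barkerKernel_of_ne h]
    exact barkerRate_nonneg hT hπ0 x y

/-- `P^{(B)}` is a transition matrix (for `T ≥ 0` with row sums `≤ 1`, `π ≥ 0`).
[cite: Peskun1973, §1 eqs. (2)–(3)] -/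
theorem barkerKernel_isRowStochastic {T : X → X → ℝ} {π : X → ℝ} (hT : ∀ x y, 0 ≤ T x y)
    (hTrow : ∀ x, ∑ y, T x y ≤ 1) (hπ0 : ∀ x, 0 ≤ π x) : IsRowStochastic (barkerKernel T π) :=
  ⟨barkerKernel_nonneg hT hTrow hπ0, barkerKernel_sum_eq_one T π⟩

/-! ## `P^{(B)} ≤ P^{(M)} ≤ 2P^{(B)}` off the diagonal -/

omit [Fintype X] [DecidableEq X] in
/-- **Barker is dominated by Metropolis**: `P^{(B)}(x,y) ≤ P^{(M)}(x,y)` (the rates, for `T ≥ 0`,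
`π > 0`) — "`s_ij ≤ 1 + min(t_ij, t_ji)` … equality is attained in (5) for `s_ij = s^{(M)}_ij`".
[cite: Peskun1973, §2.2 eqs. (5)–(6)] -/
theorem barkerRate_le_mhRate {T : X → X → ℝ} (hT : ∀ x y, 0 ≤ T x y) {π : X → ℝ}
    (hπ : ∀ x, 0 < π x) (x y : X) : barkerRate T π x y ≤ mhRate T π x y := by
  have hπ0 : ∀ z, 0 ≤ π z := fun z => (hπ z).le
  unfold mhRate
  refine le_min (barkerRate_le hT hπ0 x y) ?_
  -- `π(x)P^{(B)}(x,y) = AB/(A+B) ≤ B = π(y)T(y,x)`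
  rw [le_div_iff₀ (hπ x), mul_comm, mul_barkerRate]
  set A := π x * T x y
  set B := π y * T y x
  have hA : 0 ≤ A := mul_nonneg (hπ0 x) (hT x y)
  have hB : 0 ≤ B := mul_nonneg (hπ0 y) (hT y x)
  have h1 : A / (A + B) ≤ 1 := div_le_one_of_le₀ (le_add_of_nonneg_right hB) (add_nonneg hA hB)
  calc A * B / (A + B) = B * (A / (A + B)) := by ring
    _ ≤ B * 1 := mul_le_mul_of_nonneg_left h1 hB
    _ = B := mul_one B

omit [Fintype X] [DecidableEq X] in
/-- **Metropolis is at most twice Barker**: `P^{(M)}(x,y) ≤ 2P^{(B)}(x,y)` (the rates, `T ≥ 0`,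
`π > 0`) — (13.9)–(13.10): `1 ∧ r² ≤ 2·r²/(1 + r²)`, i.e. `min(A,B) ≤ 2AB/(A+B)` for the fluxes
`A = π(x)T(x,y)`, `B = π(y)T(y,x)`. [cite: LevinPeres2017, §13.3 Example 13.14 eqs. (13.9)–(13.10)] -/
theorem mhRate_le_two_mul_barkerRate {T : X → X → ℝ} (hT : ∀ x y, 0 ≤ T x y) {π : X → ℝ}
    (hπ : ∀ x, 0 < π x) (x y : X) : mhRate T π x y ≤ 2 * barkerRate T π x y := by
  have hπ0 : ∀ z, 0 ≤ π z := fun z => (hπ z).le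
  refine le_of_mul_le_mul_left ?_ (hπ x)
  rw [mul_mhRate hπ, mul_left_comm, mul_barkerRate]
  set A := π x * T x y
  set B := π y * T y x
  have hA : 0 ≤ A := mul_nonneg (hπ0 x) (hT x y)
  have hB : 0 ≤ B := mul_nonneg (hπ0 y) (hT y x)
  rcases (add_nonneg hA hB).eq_or_lt with h0 | hpos
  · -- `A = B = 0`
    have hA0 : A = 0 := by linarith
    have hB0 : B = 0 := by linarith
    rw [hA0, hB0]; simp
  · rw [← mul_div_assoc, le_div_iff₀ hpos]
    rcases le_total A B with hAB | hBA
    · rw [min_eq_left hAB]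
      nlinarith [mul_le_mul_of_nonneg_left hAB hA]
    · rw [min_eq_right hBA]
      nlinarith [mul_le_mul_of_nonneg_left hBA hB]

/-! ## Dirichlet forms: `𝓔_B ≤ 𝓔_M ≤ 2𝓔_B` -/

/-- `𝓔_B(f) ≤ 𝓔_M(f)`: "`𝓔(f)/𝓔̃(f) ≤ 1`" (entrywise `P ≤ P̃` and monotonicity of the Dirichlet form
in the off-diagonal entries). [cite: LevinPeres2017, §13.3 Example 13.14 ("`½ ≤ 𝓔(f)/𝓔̃(f) ≤ 1`")] -/
theorem dirichletForm_barkerKernel_le {T : X → X → ℝ} (hT : ∀ x y, 0 ≤ T x y) {π : X → ℝ}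
    (hπ : ∀ x, 0 < π x) (f : X → ℝ) :
    dirichletForm π (barkerKernel T π) f ≤ dirichletForm π (mhKernel T π) f := by
  refine dirichletForm_mono (fun x => (hπ x).le) (fun x y hxy => ?_) f
  show barkerKernel T π x y ≤ mhKernel T π x y
  rw [barkerKernel_of_ne (Ne.symm hxy), mhKernel_of_ne (Ne.symm hxy)]
  exact barkerRate_le_mhRate hT hπ x y

/-- `𝓔_M(f) ≤ 2𝓔_B(f)`: "`½ ≤ 𝓔(f)/𝓔̃(f)`" (entrywise `P̃ ≤ 2P`, Remark 13.19 with `π̃ = π`).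
[cite: LevinPeres2017, §13.3 Example 13.14 ("`½ ≤ 𝓔(f)/𝓔̃(f) ≤ 1`") with Remark 13.19] -/
theorem dirichletForm_mhKernel_le_two_mul {T : X → X → ℝ} (hT : ∀ x y, 0 ≤ T x y)
    (hTrow : ∀ x, ∑ y, T x y ≤ 1) {π : X → ℝ} (hπ : ∀ x, 0 < π x) (f : X → ℝ) :
    dirichletForm π (mhKernel T π) f ≤ 2 * dirichletForm π (barkerKernel T π) f := by
  have hπ0 : ∀ x, 0 ≤ π x := fun x => (hπ x).le
  have h := LevinPeres2017_remark_13_19 (π := π) (πt := π) (P := barkerKernel T π)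
    (Pt := mhKernel T π) hπ0 (mhKernel_nonneg hT hTrow hπ) (β := 2) (c' := 1)
    (fun x y hxy => by
      show mhKernel T π x y ≤ 2 * barkerKernel T π x y
      rw [barkerKernel_of_ne (Ne.symm hxy), mhKernel_of_ne (Ne.symm hxy)]
      exact mhRate_le_two_mul_barkerRate hT hπ x y)
    (fun x => by rw [one_mul]) f
  simpa using h

/-! ## Example 13.14: the gaps, `γ_B ≤ γ_M ≤ 2γ_B` -/

/-- **Example 13.14 (Metropolis and Glauber/Barker dynamics), general form.**  For a positive
probability vector `π` on a finite `X` with `|X| ≥ 2` and a proposal matrix `T ≥ 0` with row sums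
`≤ 1`, the spectral gaps of Barker's chain `P = P^{(B)}` and of the Metropolis–Hastings chain
`P̃ = P^{(M)}` (both reversible with respect to `π`) satisfy **`γ ≤ γ̃ ≤ 2γ`**.
[cite: LevinPeres2017, §13.3 Example 13.14 ("Therefore, the gaps are related by `γ ≤ γ̃ ≤ 2γ`")] -/
theorem LevinPeres2017_example_13_14 [Nontrivial X] {T : X → X → ℝ} (hT : ∀ x y, 0 ≤ T x y)
    (hTrow : ∀ x, ∑ y, T x y ≤ 1) {π : X → ℝ} (hπ : ∀ x, 0 < π x) (hπ1 : ∑ x, π x = 1) :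
    spectralGap π (barkerKernel T π) ≤ spectralGap π (mhKernel T π) ∧
      spectralGap π (mhKernel T π) ≤ 2 * spectralGap π (barkerKernel T π) := by
  have hπ0 : ∀ x, 0 ≤ π x := fun x => (hπ x).le
  have hB : IsRowStochastic (barkerKernel T π) := barkerKernel_isRowStochastic hT hTrow hπ0
  have hM : IsRowStochastic (mhKernel T π) := mhKernel_isRowStochastic hT hTrow hπ
  have hDBB : DetailedBalance π (barkerKernel T π) := barkerKernel_detailedBalance T π
  have hDBM : DetailedBalance π (mhKernel T π) := mhKernel_detailedBalance hπ T
  have hc : ∀ x, π x ≤ 1 * π x := fun x => by rw [one_mul]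
  constructor
  · -- `𝓔_B ≤ 1·𝓔_M ⇒ γ_B ≤ 1·1·γ_M`
    have h := LevinPeres2017_lemma_13_18 (P := mhKernel T π) (Pt := barkerKernel T π) hπ hπ1 hπ hπ1
      hM hDBM hB hDBB (α := 1) (fun f => by
        rw [one_mul]; exact dirichletForm_barkerKernel_le hT hπ f) hc
    simpa using h
  · -- `𝓔_M ≤ 2·𝓔_B ⇒ γ_M ≤ 1·2·γ_B`
    have h := LevinPeres2017_lemma_13_18 (P := barkerKernel T π) (Pt := mhKernel T π) hπ hπ1 hπ hπ1
      hB hDBB hM hDBM (α := 2) (dirichletForm_mhKernel_le_two_mul hT hTrow hπ) hc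
    simpa using h

/-! ## Peskun: `v(f, π, P^{(M)}) ≤ v(f, π, P^{(B)})` -/

/-- **Metropolis is asymptotically at least as precise as Barker**: for a positive probability
vector `π`, a proposal matrix `T ≥ 0` with row sums `≤ 1`, and an irreducible Barker chain,
`v(f, π, P^{(M)}) ≤ v(f, π, P^{(B)})` for every `f` — Peskun's Theorem 2.2.1 (`P^{(B)}` belongs to
Hastings' class: reversible with `p_ij ≤ q_ij`). [cite: Peskun1973, §2.2 Thm 2.2.1; §2.3 (display,
first inequality "`v(f,π,P^{(M)}) ≤ v(f,π,P^{(B)})`")] -/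
theorem asympVar_mhKernel_le_barkerKernel {T : X → X → ℝ} (hT : ∀ x y, 0 ≤ T x y)
    (hTrow : ∀ x, ∑ y, T x y ≤ 1) {π : X → ℝ} (hπ : ∀ x, 0 < π x) (hπ1 : ∑ x, π x = 1)
    (hirr : IsIrreducible (barkerKernel T π)) (f : X → ℝ) :
    asympVar f π (mhKernel T π) ≤ asympVar f π (barkerKernel T π) :=
  asympVar_mhKernel_le hπ hπ1 hT hTrow (barkerKernel_isRowStochastic hT hTrow fun x => (hπ x).le)
    (barkerKernel_detailedBalance T π) hirr
    (fun x y hxy => by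
      show barkerKernel T π x y ≤ T x y
      rw [barkerKernel_of_ne (Ne.symm hxy)]
      exact barkerRate_le hT (fun z => (hπ z).le) x y) f

end Literature.Probability.MarkovChains
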